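import Summits.Ventures.DiscreteObjects.Hadamard.WilliamsonArrayQuaternion668

/-!
# H(668): the sign table forced by two anticommuting nega involutions is the quaternion cocycle — the Williamson sign
# pattern (kernel lemma for the Williamson-type iff)

Framing: lottery ticket; floor = certified bounds/negative ranges.

Cell pub-namedobj (venture DiscreteObjects), target (H), hadamard gen 21.  Pure sign bookkeeping behind `Order167WilliamsonIff668`.
Let `κ₁, κ₂` be commuting permutations of `ι` with `κ₂² = 1` and `e₁, e₂ : ι → {±1}` sign vectors with the NEGA relations `e₁ (κ₁ z) = −e₁ z`,
`e₂ (κ₂ z) = −e₂ z` and the ANTICOMMUTATION relation `e₁ (κ₂ z) · e₂ z = −(e₂ (κ₁ z) · e₁ z)` — exactly what gen 21 proved for the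
column parts of two centralising signed automorphisms of an element of order `167` with distinct non-trivial involution pairs
(`centralizer167_involution_nega`, `centralizer167_involutions_anticommute`).  Label `V₄ = ℤ/2 × ℤ/2`, `Q_g = κ₁^{g₁} κ₂^{g₂}` and let
`E_g` be the column-sign vector of `τ₁^{g₁} τ₂^{g₂}` (`E_g j = cyc κ₁ e₁ (κ₂^{g₂} j) g₁ · cyc κ₂ e₂ j g₂`, i.e. `1, e₁, e₂, e₁∘κ₂ · e₂`).
**`quaternion_cocycle`**: for all `g, k ∈ V₄` and `y`,
`E_g (Q_k y) · E_k y = ε(g,k) · E_{g+k} y` with the explicit table `ε` (rows `g = 0, a, b, a+b`; columns `k` likewise):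
`(+ + + + / + − + − / + − − + / + + − −)` — the `2`-cocycle of the quaternion group `Q₈ → V₄`, `ε(g,k) = (−1)^{g₁k₁ + g₂k₁ + g₂k₂}`;
and **`thetaW_eq_cocycle`**: `θ_W(g,h) = ε(g, g+h)` for the Williamson sign table `θ_W` of `WilliamsonArrayQuaternion668` (decide).
Elementary (16 × 8 sign cases); ours; no `sorry`, no definitions, default heartbeats.
-/

namespace Summit.Ventures.DiscreteObjects.Hadamard

open Finset BigOperators Matrix

variable {ι : Type*}

/-- the four elements of `V₄` -/
lemma v4_cases (g : ZMod 2 × ZMod 2) : g = (0, 0) ∨ g = (1, 0) ∨ g = (0, 1) ∨ g = (1, 1) := by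
  revert g; decide

/-- `θ_W(g,h) = ε(g, g+h)`: the Williamson sign table is the quaternion cocycle read at `(g, g+h)` -/
lemma thetaW_eq_cocycle : ∀ g h : ZMod 2 × ZMod 2,
    (if g = 0 then (1 : ℤ) else if g = (1, 0) then (if h.1 = 1 then 1 else -1)
      else if g = (0, 1) then (if h.1 = h.2 then -1 else 1) else (if h.2 = 1 then 1 else -1)) =
    (if g = 0 ∨ g + h = 0 then (1 : ℤ) else if g = (1, 0) then (if (g + h).1 = 1 then -1 else 1)
      else if g = (0, 1) then (if g + h = (1, 1) then 1 else -1) else (if g + h = (1, 0) then 1 else -1)) := by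
  decide

/-- **The quaternion cocycle.**  See the module docstring. -/
theorem quaternion_cocycle {κ₁ κ₂ : Equiv.Perm ι} {e₁ e₂ : ι → ℤ} (he₁ : ∀ j, e₁ j = 1 ∨ e₁ j = -1)
    (he₂ : ∀ j, e₂ j = 1 ∨ e₂ j = -1) (hcomm : Commute κ₁ κ₂) (hi₂ : κ₂ ^ 2 = 1)
    (hN1 : ∀ z, e₁ (κ₁ z) = -e₁ z) (hN2 : ∀ z, e₂ (κ₂ z) = -e₂ z)
    (hAC : ∀ z, e₁ (κ₂ z) * e₂ z = -(e₂ (κ₁ z) * e₁ z)) (g k : ZMod 2 × ZMod 2) (y : ι) :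
    (cyc κ₁ e₁ ((κ₂ ^ g.2.val) ((κ₁ ^ k.1.val * κ₂ ^ k.2.val) y)) g.1.val *
        cyc κ₂ e₂ ((κ₁ ^ k.1.val * κ₂ ^ k.2.val) y) g.2.val) *
      (cyc κ₁ e₁ ((κ₂ ^ k.2.val) y) k.1.val * cyc κ₂ e₂ y k.2.val) =
    (if g = 0 ∨ k = 0 then (1 : ℤ) else if g = (1, 0) then (if k.1 = 1 then -1 else 1)
      else if g = (0, 1) then (if k = (1, 1) then 1 else -1) else (if k = (1, 0) then 1 else -1)) *
      (cyc κ₁ e₁ ((κ₂ ^ (g + k).2.val) y) (g + k).1.val * cyc κ₂ e₂ y (g + k).2.val) := by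
  -- pointwise consequences of the relations
  have hinv2 : ∀ z, κ₂ (κ₂ z) = z := fun z => by
    rw [← Equiv.Perm.mul_apply, ← pow_two, hi₂, Equiv.Perm.one_apply]
  have hcpt : ∀ z, κ₂ (κ₁ z) = κ₁ (κ₂ z) := fun z => by
    rw [← Equiv.Perm.mul_apply, ← hcomm.eq, Equiv.Perm.mul_apply]
  have hD3 : ∀ z, e₂ (κ₁ z) = -(e₁ (κ₂ z) * e₂ z * e₁ z) := by
    intro z
    have h := hAC z
    have hsq := pm_mul_self (he₁ z)
    linear_combination (e₁ z) * h - (e₂ (κ₁ z)) * hsq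
  -- numerals in ZMod 2 × ZMod 2
  have v10 : ((1, 0) : ZMod 2 × ZMod 2).1.val = 1 := rfl
  have v10' : ((1, 0) : ZMod 2 × ZMod 2).2.val = 0 := rfl
  have v01 : ((0, 1) : ZMod 2 × ZMod 2).1.val = 0 := rfl
  have v01' : ((0, 1) : ZMod 2 × ZMod 2).2.val = 1 := rfl
  have v11 : ((1, 1) : ZMod 2 × ZMod 2).1.val = 1 := rfl
  have v11' : ((1, 1) : ZMod 2 × ZMod 2).2.val = 1 := rfl
  have v00 : ((0, 0) : ZMod 2 × ZMod 2).1.val = 0 := rfl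
  have v00' : ((0, 0) : ZMod 2 × ZMod 2).2.val = 0 := rfl
  have s1 : ((1, 0) : ZMod 2 × ZMod 2) + (1, 0) = (0, 0) := by decide
  have s2 : ((1, 0) : ZMod 2 × ZMod 2) + (0, 1) = (1, 1) := by decide
  have s3 : ((1, 0) : ZMod 2 × ZMod 2) + (1, 1) = (0, 1) := by decide
  have s4 : ((0, 1) : ZMod 2 × ZMod 2) + (1, 0) = (1, 1) := by decide
  have s5 : ((0, 1) : ZMod 2 × ZMod 2) + (0, 1) = (0, 0) := by decide
  have s6 : ((0, 1) : ZMod 2 × ZMod 2) + (1, 1) = (1, 0) := by decide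
  have s7 : ((1, 1) : ZMod 2 × ZMod 2) + (1, 0) = (0, 1) := by decide
  have s8 : ((1, 1) : ZMod 2 × ZMod 2) + (0, 1) = (1, 0) := by decide
  have s9 : ((1, 1) : ZMod 2 × ZMod 2) + (1, 1) = (0, 0) := by decide
  have t1 : ((1, 0) : ZMod 2 × ZMod 2) ≠ 0 := by decide
  have t2 : ((0, 1) : ZMod 2 × ZMod 2) ≠ 0 := by decide
  have t3 : ((1, 1) : ZMod 2 × ZMod 2) ≠ 0 := by decide
  have t4 : ((0, 1) : ZMod 2 × ZMod 2) ≠ (1, 0) := by decide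
  have t5 : ((1, 1) : ZMod 2 × ZMod 2) ≠ (1, 0) := by decide
  have t6 : ((1, 1) : ZMod 2 × ZMod 2) ≠ (0, 1) := by decide
  have t7 : ((1, 0) : ZMod 2 × ZMod 2) ≠ (1, 1) := by decide
  have t8 : ((0, 1) : ZMod 2 × ZMod 2) ≠ (1, 1) := by decide
  have t9 : ((0, 0) : ZMod 2 × ZMod 2) = 0 := rfl
  have ha := pm_mul_self (he₁ y)
  have hb := pm_mul_self (he₂ y)
  have hf := pm_mul_self (he₁ (κ₂ y))
  rcases v4_cases g with rfl | rfl | rfl | rfl <;> rcases v4_cases k with rfl | rfl | rfl | rfl <;>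
    simp only [v10, v10', s1, s2, s3, s4, s5, s6, s7, s8, s9, t9, add_zero, zero_add,
      cyc, Finset.prod_range_zero, Finset.prod_range_one, pow_zero, pow_one, Equiv.Perm.one_apply, Equiv.Perm.mul_apply,
      mul_one, one_mul, hcpt, hinv2, hN1, hN2, hD3, or_true, if_true, if_false, t1, t2, t3,
      t4, t5, t6, t7, t8, or_false, Prod.mk.injEq, one_ne_zero, zero_ne_one, and_false] <;>
    (rcases he₁ y with h1 | h1 <;> rcases he₂ y with h2 | h2 <;> rcases he₁ (κ₂ y) with h3 | h3 <;>
      (try simp only [h1, h2, h3]) <;> norm_num)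

end Summit.Ventures.DiscreteObjects.Hadamard
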